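/-
Copyright (c) 2026 the pub-hodgecm-mathlib formalisation cell (harness21).  Prover seat hodgecm-mathlib-K2Liu-p11 (g2), Track B «K2-LIT»,
#184♮ = hLiu418 = `stmt-HodgeConjecture-24832`; #41 G6-arch (A∞-hol) for general `K_w`-type (LEAD F0P6-plan (g14) BATCH #28 (3)), piece (H1) of my census 14:17Z.
THEOREMS ONLY (no `def`, no `instance`, no notation, no named-fact hypothesis, no `sorry`); GENERIC linear algebra + one-variable holomorphy bookkeeping.
-/
import Mathlib.Analysis.Complex.Basic
import Mathlib.Analysis.Calculus.Deriv.Basic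
import Mathlib.Analysis.Calculus.FDeriv.Mul
import Mathlib.Analysis.Calculus.FDeriv.Add
import Mathlib.Analysis.Calculus.Deriv.Inv
import Mathlib.Algebra.BigOperators.Group.Finset.Basic
import Mathlib.LinearAlgebra.Span.Basic
import HarnessLib

/-!
# Crux `HLiu418`, G6-arch (A∞-hol), (H1): AN INTERTWINER ON A LADDER OF `K`-TYPES — scalar transfer along live arrows, path products, and their holomorphy

Cell `hodgecm-mathlib`, crux item hLiu418 = `stmt-HodgeConjecture-24832` (helper lane `--supports`, count-neutral).

ABSTRACT SETTING (instance = the compact picture of `I_w(s)` on `U(2,2)`: `T := M*_w(s)`, `A := P^{(p(s))}_{ab}` ∕ `M^{(q(s))}_{ab}` on the source, `B :=` the same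
operators with the parameter of `I_w(−s)` on the target, `x, y :=` highest-weight vectors `F_{k,l}` of two adjacent `K_w`-types, ★ S2-T transition scalars `a, b`):
a linear `T : V →ₗ V` with `T ∘ A = B ∘ T`; an ARROW `A x = a • y`, `B x = b • y`; `T` acting by scalars on the two vectors, `T x = c • x`, `T y = c′ • y`.
* §1 **`scalar_transfer`**: `y ≠ 0 → a * c′ = b * c` — hence `c′ = b * c ∕ a` on a LIVE arrow (`a ≠ 0`), and `b * c = 0` on a DEAD one (`a = 0`: either `c = 0` or the
  target arrow scalar vanishes too — the source of the ⚠️ flag of the census);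
* §2 **`scalar_path`** — along a chain of live arrows `x₀ → x₁ → ⋯ → x_n`: `c_n = c₀ · ∏_{i<n} (b_i ∕ a_i)`; `scalar_unique` (two live paths agree);
* §4 (appended) **`apply_target_eq_smul`** ∕ **`apply_end_eq_smul`** — the FORWARD transfer: `T` is scalar on every vertex reachable by live arrows from a scalar anchor
  (no multiplicity-one ∕ Schur input — (H3) of the census is not needed);
* §3 **`differentiableOn_path_scalar`** — with a parameter: if `c₀`, `a_i`, `b_i` are holomorphic on `U` and the `a_i` do not vanish on `U`, the path scalar
  `s ↦ c₀(s) · ∏ (b_i(s) ∕ a_i(s))` is holomorphic on `U` ((A∞-hol) for the K-type at the end of the path, given (A) for the anchor and the LIVE-ARROW hypothesis on `U`).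
References: [LeeZhu1998, §5]; [KudlaRallis1994 (citation)]; [Shimura1997, §16.4].
HONEST LABEL: HC_CM is proved only modulo the 7 printed citations (2 remaining named inputs: hLiu418 = stmt-HodgeConjecture-24832,
h413 = stmt-HodgeConjecture-24833) until rung 0 closes; count-neutral helper, closes no socket.
-/

set_option autoImplicit false
set_option linter.dupNamespace false

namespace Summit.HodgeConjecture.HodgeConjecture.Cruxes.HLiu418.K2LiuLadderIntertwinerScalars

open Complex Set

variable {𝕜 : Type*} [Field 𝕜] {V : Type*} [AddCommGroup V] [Module 𝕜 V]

/-! ## §1  One arrow -/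

/-- **SCALAR TRANSFER ALONG AN ARROW.** `T ∘ A = B ∘ T` (on `x`), `A x = a • y`, `B x = b • y`, `T x = c • x`, `T y = c′ • y`, `y ≠ 0` ⇒ `a · c′ = b · c`. [LeeZhu1998, §5] -/
theorem scalar_transfer (T A B : V →ₗ[𝕜] V) {x y : V} {a b c c' : 𝕜} (hTA : T (A x) = B (T x)) (hA : A x = a • y) (hB : B x = b • y)
    (hTx : T x = c • x) (hTy : T y = c' • y) (hy : y ≠ 0) : a * c' = b * c := by
  have h : (a * c') • y = (b * c) • y := by
    rw [mul_smul, ← hTy, ← map_smul, ← hA, hTA, hTx, map_smul, hB, smul_smul, mul_comm]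
  exact smul_left_injective 𝕜 hy h

/-- On a LIVE arrow (`a ≠ 0`): `c′ = b · c ∕ a`. [LeeZhu1998, §5] -/
theorem scalar_transfer_div (T A B : V →ₗ[𝕜] V) {x y : V} {a b c c' : 𝕜} (hTA : T (A x) = B (T x)) (hA : A x = a • y) (hB : B x = b • y)
    (hTx : T x = c • x) (hTy : T y = c' • y) (hy : y ≠ 0) (ha : a ≠ 0) : c' = b * c / a := by
  rw [eq_div_iff ha, mul_comm c' a]
  exact scalar_transfer T A B hTA hA hB hTx hTy hy

/-- On a DEAD arrow (`a = 0`): `b · c = 0` — the intertwiner kills `x` or the target arrow is dead too. [LeeZhu1998, §5] -/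
theorem mul_eq_zero_of_dead (T A B : V →ₗ[𝕜] V) {x y : V} {b c c' : 𝕜} (hTA : T (A x) = B (T x)) (hA : A x = (0 : 𝕜) • y) (hB : B x = b • y)
    (hTx : T x = c • x) (hTy : T y = c' • y) (hy : y ≠ 0) : b * c = 0 := by
  have h := scalar_transfer T A B hTA hA hB hTx hTy hy
  rw [zero_mul] at h
  exact h.symm

/-- The scalar by which `T` acts on a nonzero vector is unique. [folklore] -/
theorem scalar_unique (T : V →ₗ[𝕜] V) {x : V} {c c' : 𝕜} (h : T x = c • x) (h' : T x = c' • x) (hx : x ≠ 0) : c = c' :=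
  smul_left_injective 𝕜 hx (h.symm.trans h')

/-! ## §2  A path of live arrows -/

/-- **PATH PRODUCT.** Along a chain `x 0 → x 1 → ⋯ → x n` of arrows (`A i (x i) = a i • x (i+1)`, `B i (x i) = b i • x (i+1)`, all `x i ≠ 0`, all `a i ≠ 0`) intertwined by
`T` (`T (A i (x i)) = B i (T (x i))`) on which `T` acts by scalars `c i`: `c n = c 0 · ∏_{i<n} (b i ∕ a i)`. [LeeZhu1998, §5] -/
theorem scalar_path (T : V →ₗ[𝕜] V) (n : ℕ) (A B : ℕ → (V →ₗ[𝕜] V)) (x : ℕ → V) (a b c : ℕ → 𝕜)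
    (hTA : ∀ i < n, T (A i (x i)) = B i (T (x i))) (hA : ∀ i < n, A i (x i) = a i • x (i + 1)) (hB : ∀ i < n, B i (x i) = b i • x (i + 1))
    (hT : ∀ i ≤ n, T (x i) = c i • x i) (hx : ∀ i ≤ n, x i ≠ 0) (ha : ∀ i < n, a i ≠ 0) :
    c n = c 0 * ∏ i ∈ Finset.range n, (b i / a i) := by
  induction n with
  | zero => simp
  | succ n ih =>
    have hcn : c n = c 0 * ∏ i ∈ Finset.range n, (b i / a i) :=
      ih (fun i hi => hTA i (by omega)) (fun i hi => hA i (by omega)) (fun i hi => hB i (by omega)) (fun i hi => hT i (by omega))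
        (fun i hi => hx i (by omega)) (fun i hi => ha i (by omega))
    have hstep : c (n + 1) = b n * c n / a n :=
      scalar_transfer_div T (A n) (B n) (hTA n (by omega)) (hA n (by omega)) (hB n (by omega)) (hT n (by omega)) (hT (n + 1) le_rfl)
        (hx (n + 1) le_rfl) (ha n (by omega))
    rw [hstep, hcn, Finset.prod_range_succ]
    field_simp

/-- **TWO LIVE PATHS AGREE**: the end scalar does not depend on the path (it is THE scalar of `T` on the end vector). [folklore] -/
theorem path_scalars_agree (T : V →ₗ[𝕜] V) {x : V} {c₁ c₂ : 𝕜} (h₁ : T x = c₁ • x) (h₂ : T x = c₂ • x) (hx : x ≠ 0) : c₁ = c₂ :=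
  scalar_unique T h₁ h₂ hx

/-! ## §3  Holomorphy of path scalars in a parameter -/

/-- A finite product of functions holomorphic on `U` is holomorphic on `U`. [folklore] -/
theorem differentiableOn_finset_prod {ι : Type*} (U : Set ℂ) (s : Finset ι) (f : ι → ℂ → ℂ) (hf : ∀ i ∈ s, DifferentiableOn ℂ (f i) U) :
    DifferentiableOn ℂ (fun z => ∏ i ∈ s, f i z) U := by
  classical
  induction s using Finset.induction_on with
  | empty => simp
  | @insert j s hj ih =>
    have h : (fun z => ∏ i ∈ insert j s, f i z) = fun z => f j z * ∏ i ∈ s, f i z := funext fun z => Finset.prod_insert hj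
    rw [h]
    exact (hf j (Finset.mem_insert_self j s)).mul (ih fun i hi => hf i (Finset.mem_insert_of_mem hi))

/-- **(A∞-hol) ALONG A LIVE PATH.** If the anchor scalar `c₀` and the arrow scalars `a_i, b_i` are holomorphic on `U` and NO source arrow dies on `U` (`a_i(s) ≠ 0`), the
end scalar `s ↦ c₀(s) · ∏_{i<n} (b_i(s) ∕ a_i(s))` is holomorphic on `U`. [LeeZhu1998, §5] [Shimura1997, §16.4] -/
theorem differentiableOn_path_scalar (U : Set ℂ) (n : ℕ) (c₀ : ℂ → ℂ) (a b : ℕ → ℂ → ℂ) (hc₀ : DifferentiableOn ℂ c₀ U)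
    (ha : ∀ i < n, DifferentiableOn ℂ (a i) U) (hb : ∀ i < n, DifferentiableOn ℂ (b i) U) (ha0 : ∀ i < n, ∀ z ∈ U, a i z ≠ 0) :
    DifferentiableOn ℂ (fun z => c₀ z * ∏ i ∈ Finset.range n, (b i z / a i z)) U :=
  hc₀.mul (differentiableOn_finset_prod U (Finset.range n) (fun i z => b i z / a i z) fun i hi =>
    (hb i (Finset.mem_range.1 hi)).div (ha i (Finset.mem_range.1 hi)) (ha0 i (Finset.mem_range.1 hi)))

/-- **THE END SCALAR AS A FUNCTION**: if for every `z ∈ U` the ladder data at parameter `z` satisfy §2's hypotheses with scalars `a i z, b i z, c i z`, then `c n` agrees on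
`U` with the holomorphic path scalar — so `c n` is holomorphic on `U`. [LeeZhu1998, §5] -/
theorem differentiableOn_end_scalar (U : Set ℂ) (n : ℕ) (a b c : ℕ → ℂ → ℂ) (hpath : ∀ z ∈ U, c n z = c 0 z * ∏ i ∈ Finset.range n, (b i z / a i z))
    (hc₀ : DifferentiableOn ℂ (c 0) U) (ha : ∀ i < n, DifferentiableOn ℂ (a i) U) (hb : ∀ i < n, DifferentiableOn ℂ (b i) U)
    (ha0 : ∀ i < n, ∀ z ∈ U, a i z ≠ 0) : DifferentiableOn ℂ (c n) U :=
  (differentiableOn_path_scalar U n (c 0) a b hc₀ ha hb ha0).congr fun z hz => hpath z hz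

/-- Affine arrow scalars `z ↦ α z + β` (the ★ S2-T shape `p(s) − l`, `p(s) − k − l − 1`, …, `p(s) = s + const`) are entire and vanish at ONE point; off that point
the live-arrow hypothesis holds. [folklore] -/
theorem differentiableOn_affine (U : Set ℂ) (α β : ℂ) : DifferentiableOn ℂ (fun z : ℂ => α * z + β) U :=
  ((differentiable_id.const_mul α).add_const β).differentiableOn

/-- The live-arrow locus of an affine scalar: `α z + β ≠ 0` iff `z ≠ −β∕α` (`α ≠ 0`). [folklore] -/
theorem affine_ne_zero_iff {α β z : ℂ} (hα : α ≠ 0) : α * z + β ≠ 0 ↔ z ≠ -β / α := by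
  rw [ne_eq, ne_eq, not_iff_not, eq_div_iff hα, eq_neg_iff_add_eq_zero, mul_comm]

/-! ## §4  (appended) The FORWARD transfer — no multiplicity-one input needed -/

/-- **FORWARD SCALAR TRANSFER (removes the multiplicity-one hypothesis (H3)).**  If `T` intertwines `A` with `B` on `x`, the arrow `A x = a • y` is LIVE (`a ≠ 0`),
`B x = b • y`, and `T` acts on `x` by the scalar `c`, then `T` acts on `y` by a scalar TOO, namely `b c ∕ a` — by computation, `T y = a⁻¹ • T (A x) = a⁻¹ • B (c • x)`.
So along any live path from an anchor on which `T` is scalar, `T` is scalar on every vertex (no Schur ∕ multiplicity-freeness needed). [LeeZhu1998, §5] -/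
theorem apply_target_eq_smul (T A B : V →ₗ[𝕜] V) {x y : V} {a b c : 𝕜} (hTA : T (A x) = B (T x)) (hA : A x = a • y) (hB : B x = b • y)
    (hTx : T x = c • x) (ha : a ≠ 0) : T y = (b * c / a) • y := by
  have hy : y = a⁻¹ • A x := by rw [hA, smul_smul, inv_mul_cancel₀ ha, one_smul]
  rw [hy, map_smul, hTA, hTx, map_smul, hB, smul_smul, smul_smul]
  congr 1
  field_simp

/-- **FORWARD PATH**: along a chain of live arrows from an anchor on which `T` is scalar, `T` is scalar on every vertex, with the path-product value
`c₀ · ∏_{i<n} (b_i ∕ a_i)` at the end. [LeeZhu1998, §5] -/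
theorem apply_end_eq_smul (T : V →ₗ[𝕜] V) (n : ℕ) (A B : ℕ → (V →ₗ[𝕜] V)) (x : ℕ → V) (a b : ℕ → 𝕜) (c₀ : 𝕜)
    (hTA : ∀ i < n, T (A i (x i)) = B i (T (x i))) (hA : ∀ i < n, A i (x i) = a i • x (i + 1)) (hB : ∀ i < n, B i (x i) = b i • x (i + 1))
    (hT0 : T (x 0) = c₀ • x 0) (ha : ∀ i < n, a i ≠ 0) :
    T (x n) = (c₀ * ∏ i ∈ Finset.range n, (b i / a i)) • x n := by
  induction n with
  | zero => simpa using hT0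
  | succ n ih =>
    have hn : T (x n) = (c₀ * ∏ i ∈ Finset.range n, (b i / a i)) • x n :=
      ih (fun i hi => hTA i (by omega)) (fun i hi => hA i (by omega)) (fun i hi => hB i (by omega)) (fun i hi => ha i (by omega))
    rw [apply_target_eq_smul T (A n) (B n) (hTA n (by omega)) (hA n (by omega)) (hB n (by omega)) hn (ha n (by omega)), Finset.prod_range_succ]
    congr 1
    field_simp

end Summit.HodgeConjecture.HodgeConjecture.Cruxes.HLiu418.K2LiuLadderIntertwinerScalars
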